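import Summits.Ventures.MM22.Rank333.GF2CertTransport
import Summits.Ventures.MM22.Rank333.LowerBounds
import Summits.MatrixMultiplication.OmegaCensus.SmallFormats.GF2FastTable
import HarnessLib

/-!
# MM22 venture — `R_{𝔽₂}(⟨3,3,3⟩) ≥ 21` from ten orbit bounds: the CLIQUE-COVER profile argument (checker + soundness)

HONEST FRAMING (cell `pub-mm22`, seat bench g5; v4 item (0) «ROOT ⟸ 480», kernel form). This file is checker
PLUMBING with a soundness theorem; it proves NO bound on `⟨3,3,3⟩` by itself. The end theorem of the sibling data
file (`Root21Of480.lean`: `rankGe21F2_of_480`) is CONDITIONAL on nine orbit bounds `Cert 3 3 3 K b` of Wang-2026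
type (one of them, `Cert 3 3 3 [1,16] 19` = "orbit 480 at 19", is OPEN; the others are certified by the cell's exact
LP / LP-DFS certificates or are Wang's printed values, none of which is replayed here). Nothing in these files proves
`RankGe21F2`.

THE ARGUMENT (engine-1's «480 ≥ 19 ⇒ root ≥ 21» lemma of 2026-08-22, recast as a clique cover so that the kernel
work is a few hundred sandwich checks instead of a DFS): let `β` be a bilinear computation of `(X, Y) ↦ X Y` on
`𝔽₂^{3×3} × 𝔽₂^{3×3}` with `r` products. Discard the products with zero `X`-form (`exists_forall_f_ne_zero`); every
remaining `X`-form is one of the 511 nonzero bit-pattern forms (`coverB`). SUBSTITUTION (Wang 2026 Lemma 3 = the tree's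
`BilinComp.restrictAlong`): if the `X`-forms of the products in `J` are listed in `K'` they vanish on `S_{K'}`, so
`Cert 3 3 3 K' b` gives `b + |J| ≤ r` (`add_card_le_of_cert`). Hence, for `r ≤ 20`: no product has an `X`-form `x`
with `Cert [x] 20` (rank 3); two products never share a form `x` with `Cert [x] 19`, nor have forms `f ≠ g` with
`Cert [f,g] 19` ("conflict"); and one product alone forces `r ≥ 20`. A CLIQUE is a list of forms that pairwise
conflict; if the forms not excluded outright are covered by at most 19 cliques, the map product ↦ clique is injective,
so `20 ≤ r ≤ 19`: contradiction, i.e. every computation has `≥ 21` products (`cert_nil_of_checks`), and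
`21 ≤ R_{𝔽₂}(⟨3,3,3⟩)` (`rankGe21F2_of_checks`). Conflicts are certified from the hypothesis orbits by explicit
sandwiches `X ↦ P X Q` through the landed FAST check `sandFBF` (= `sandFB` ⇒ `sandB` ⇒ `le_of_sandB`); a clique may
also be justified as the elementwise IMAGE of an earlier clique under an invertible sandwich (`cert_image`, the
abstract form of Wang's Lemma 1 — no enumeration), which is how the data file gets 14 cliques from 2.

References: Wang 2026 (arXiv:2603.07280) Lemma 1, Lemma 3, §6; the tree files `GF2OrbitSweep.lean`, `GF2OrbitChecks.lean`,
`GF2FastSandwich.lean`, `GF2FastTable.lean` (cell `pub-omega` / p3), `SubstitutionBacktracking.lean`,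
`ConstrainedMatMulSandwich.lean` (Literature), whose definitions and soundness theorems are reused verbatim.
-/

namespace Summit.Ventures.MM22.GF2Cert.Root21

open Module Matrix Literature.Computability.AlgebraicComplexity
open Summit.MatrixMultiplication.OmegaCensus.GF2RankLB Summit.Ventures.MM22.GF2Cert Summit.Ventures.MM22

/-! ## 1. Substitution counts at the unconstrained orbit -/

/-- Every constraint subspace lies in the unconstrained one `S_{[]}`. -/
theorem le_subOf_nil (l m : ℕ) (S : Submodule (ZMod 2) (Matrix (Fin l) (Fin m) (ZMod 2))) :
    S ≤ subOf l m [] :=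
  fun _ _ => mem_constrSub.2 (by simp)

/-- A form listed in `K` vanishes on `S_K`. -/
theorem form_eq_zero_of_mem {l m : ℕ} {K : List ℕ} {κ : ℕ} (hκ : κ ∈ K)
    {u : Matrix (Fin l) (Fin m) (ZMod 2)} (hu : u ∈ subOf l m K) : form l m κ u = 0 :=
  (mem_constrSub.1 hu) _ (List.mem_map.2 ⟨κ, hκ, rfl⟩)

/-- **Substitution count** (Wang 2026, Lemma 3, at the root): if the `X`-forms of the products in `J` are the
bit-pattern forms `c i`, all listed in `K'`, and every computation on `S_{K'}` needs `b` products, then `b + |J| ≤ r`. -/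
theorem add_card_le_of_cert {l m n r : ℕ} (β : BilinComp (psiK l m n []) (Fin r)) (c : Fin r → ℕ)
    (hc : ∀ i (u : subOf l m []), β.f i u = form l m (c i) u) (K' : List ℕ) (J : Finset (Fin r))
    (hJ : ∀ i ∈ J, c i ∈ K') {b : ℕ} (hb : Cert l m n K' b) : b + J.card ≤ r := by
  have hle : subOf l m K' ≤ subOf l m [] := le_subOf_nil l m _
  have hJ' : ∀ i ∈ J, ∀ u : subOf l m K', β.f i (Submodule.inclusion hle u) = 0 := by
    intro i hi u
    rw [hc, Submodule.coe_inclusion]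
    exact form_eq_zero_of_mem (hJ i hi) u.2
  obtain ⟨β'⟩ := β.exists_restrictAlong hle J hJ'
  have h1 := hb _ β'
  have h2 : J.card ≤ r := by simpa using Finset.card_le_univ J
  simp only [Fintype.card_fin] at h1
  omega

/-! ## 2. Normal form of a computation at the root -/

/-- All nonzero bit patterns of forms on `3 × 3` matrices, ascending. -/
def allForms : List ℕ := (List.range 511).map (· + 1)

/-- Candidate cover at the root: every nonzero form is (on `S_{[]}`) one of `allForms`. -/
theorem coverB_allForms : coverB 3 3 [] allForms = true := by
  decide +kernel

/-- **Normal form**: every computation of `ψ_{[]}` shortens to one whose `X`-forms are listed nonzero bit-pattern forms. -/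
theorem exists_normal {r : ℕ} (β : BilinComp (psiK 3 3 3 []) (Fin r)) :
    ∃ r', r' ≤ r ∧ ∃ (β' : BilinComp (psiK 3 3 3 []) (Fin r')) (c : Fin r' → ℕ),
      (∀ i, c i ∈ allForms) ∧ ∀ i (u : subOf 3 3 []), β'.f i u = form 3 3 (c i) u := by
  obtain ⟨r', hr', β', hβ'⟩ := β.exists_forall_f_ne_zero
  refine ⟨r', by simpa using hr', β', ?_⟩
  have hcov := cover_of_coverB coverB_allForms
  choose nn a ha hfa using fun i => hcov (β'.f i) (hβ' i)
  refine ⟨fun i => allForms.getD (nn i) 0, fun i => ?_, fun i u => ?_⟩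
  · show allForms.getD (nn i) 0 ∈ allForms
    rw [List.getD_eq_getElem _ _ (nn i).2]
    exact List.getElem_mem (nn i).2
  · rw [hfa i u, (by decide : ∀ t : ZMod 2, t ≠ 0 → t = 1) _ (ha i), one_mul]
    rfl

/-! ## 3. Certificate format and checker -/

/-- Hypothesis orbit bounds: `(K, b)` pairs, each read as `Cert 3 3 3 K b`. -/
abbrev Reps := List (List ℕ × ℕ)

/-- "All hypothesis orbit bounds hold." -/
def Hyps (reps : Reps) : Prop := ∀ e ∈ reps, Cert 3 3 3 e.1 e.2

/-- A sandwich witness: hypothesis index and `(P, P⁻¹, Q, Q⁻¹)` as bit patterns. -/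
abbrev Wit := ℕ × ℕ × ℕ × ℕ × ℕ

/-- The hypothesis record at an index (`([], 0)` out of range). -/
def repAt (reps : Reps) (j : ℕ) : List ℕ × ℕ := reps.getD j ([], 0)

/-- Fast check: the hypothesis orbit `w.1` has bound `≥ b` and `S_{Kt}` is a sandwich image of it (`sandFBF`). -/
def witOK (reps : Reps) (Kt : List ℕ) (b : ℕ) (w : Wit) : Bool :=
  Nat.ble b (repAt reps w.1).2 &&
    sandFBF 3 3 (repAt reps w.1).1 Kt w.2.1 w.2.2.1 w.2.2.2.1 w.2.2.2.2

/-- Ordered pairs `(f, g)` of a list with `f` listed before `g`. -/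
def pairs : List ℕ → List (ℕ × ℕ)
  | [] => []
  | f :: rest => rest.map (fun g => (f, g)) ++ pairs rest

/-- Aligned check of a list of pairs against witnesses: each pair `(f, g)` gets `Cert 3 3 3 [f, g] 19`. -/
def pairsOK (reps : Reps) : List (ℕ × ℕ) → List Wit → Bool
  | [], _ => true
  | _ :: _, [] => false
  | p :: ps, w :: ws => witOK reps [p.1, p.2] 19 w && pairsOK reps ps ws

/-- Justification of a part: its own pair witnesses, or the image of an EARLIER part under `κ ↦ P⁻ᵀ κ Q⁻ᵀ`
(stored as `(src, P, P⁻¹, Q, Q⁻¹)`; the image list must be literally the part). -/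
inductive PartJ
  /-- own witnesses, aligned with `pairs part` -/
  | own (ws : List Wit)
  /-- elementwise image of part `src` -/
  | image (src P Pi Q Qi : ℕ)

/-- Check of part `k` of `parts` against its justification. -/
def partJOK (reps : Reps) (parts : List (List ℕ)) (k : ℕ) : PartJ → Bool
  | .own ws => pairsOK reps (pairs (parts.getD k [])) ws
  | .image src P Pi Q Qi => Nat.blt src k && Nat.beq (mulBitsF 3 3 3 Pi P) (oneBits 3) &&
      Nat.beq (mulBitsF 3 3 3 Q Qi) (oneBits 3) &&
      ((parts.getD src []).map (pullBF 3 3 Pi Qi) == parts.getD k [])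

/-- Check of all parts from index `k` on, justifications aligned. -/
def partsOKFrom (reps : Reps) (parts : List (List ℕ)) : ℕ → List PartJ → Bool
  | k, [] => Nat.ble parts.length k
  | k, j :: js => partJOK reps parts k j && partsOKFrom reps parts (k + 1) js

/-- Check of the singles table, aligned with a list of forms: form `x` gets `Cert [x] b` with `b ≥ 19`, and either
`b ≥ 20` (the form can carry no product at all) or `x` lies in some part. -/
def singlesOK (reps : Reps) (parts : List (List ℕ)) : List ℕ → List (ℕ × Wit) → Bool
  | [], _ => true
  | _ :: _, [] => false
  | x :: xs, e :: es => Nat.ble 19 e.1 && witOK reps [x] e.1 e.2 &&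
      (Nat.ble 20 e.1 || parts.any fun C => C.contains x) && singlesOK reps parts xs es

/-! ## 4. Soundness of the checker -/

/-- A validated witness certifies its target. -/
theorem cert_of_witOK {reps : Reps} (hr : Hyps reps) {Kt : List ℕ} {b : ℕ} {w : Wit}
    (h : witOK reps Kt b w = true) : Cert 3 3 3 Kt b := by
  simp only [witOK, Bool.and_eq_true, Nat.ble_eq] at h
  obtain ⟨hb, hs⟩ := h
  rw [sandFBF_eq] at hs
  have hsb := sandB_of_sandFB hs
  by_cases hw : w.1 < reps.length
  · have hmem : repAt reps w.1 ∈ reps := by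
      rw [repAt, List.getD_eq_getElem _ _ hw]
      exact List.getElem_mem hw
    exact cert_mono hb (fun r β => le_of_sandB hsb (hr _ hmem) r β)
  · have h0 : repAt reps w.1 = ([], 0) := List.getD_eq_default _ _ (not_lt.1 hw)
    rw [h0] at hb
    have hb0 : b = 0 := Nat.le_zero.1 hb
    subst hb0
    exact fun r _ => Nat.zero_le r

/-- Two distinct members of a list form one of its ordered pairs. -/
theorem mem_pairs_of_mem {C : List ℕ} {f g : ℕ} (hf : f ∈ C) (hg : g ∈ C) (hne : f ≠ g) :
    (f, g) ∈ pairs C ∨ (g, f) ∈ pairs C := by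
  induction C with
  | nil => simp at hf
  | cons x rest ih =>
    simp only [pairs, List.mem_append, List.mem_map, List.mem_cons] at hf hg ⊢
    rcases hf with rfl | hf <;> rcases hg with rfl | hg
    · exact absurd rfl hne
    · exact Or.inl (Or.inl ⟨g, hg, rfl⟩)
    · exact Or.inr (Or.inl ⟨f, hf, rfl⟩)
    · rcases ih hf hg with h | h
      · exact Or.inl (Or.inr h)
      · exact Or.inr (Or.inr h)

/-- A validated pair list certifies every listed pair. -/
theorem cert_of_pairsOK {reps : Reps} (hr : Hyps reps) :
    ∀ (ps : List (ℕ × ℕ)) (ws : List Wit), pairsOK reps ps ws = true →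
      ∀ f g : ℕ, (f, g) ∈ ps → Cert 3 3 3 [f, g] 19
  | [], _, _, f, g, hp => absurd hp List.not_mem_nil
  | _ :: _, [], h, _, _, _ => by simp [pairsOK] at h
  | p :: ps, w :: ws, h, f, g, hq => by
    simp only [pairsOK, Bool.and_eq_true] at h
    rcases List.mem_cons.1 hq with hpq | hq
    · cases hpq
      exact cert_of_witOK hr h.1
    · exact cert_of_pairsOK hr ps ws h.2 f g hq

/-- A CLIQUE: any two distinct members are listed together in a 2-constraint list certified at 19. -/
def IsClique (C : List ℕ) : Prop :=
  ∀ f ∈ C, ∀ g ∈ C, f ≠ g → ∃ K' : List ℕ, f ∈ K' ∧ g ∈ K' ∧ Cert 3 3 3 K' 19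

/-- Own witnesses make a clique. -/
theorem isClique_of_pairsOK {reps : Reps} (hr : Hyps reps) {C : List ℕ} {ws : List Wit}
    (h : pairsOK reps (pairs C) ws = true) : IsClique C := by
  intro f hf g hg hne
  rcases mem_pairs_of_mem hf hg hne with hp | hp
  · exact ⟨[f, g], List.mem_cons_self, List.mem_cons_of_mem _ List.mem_cons_self,
      cert_of_pairsOK hr (pairs C) ws h f g hp⟩
  · exact ⟨[g, f], List.mem_cons_of_mem _ List.mem_cons_self, List.mem_cons_self,
      cert_of_pairsOK hr (pairs C) ws h g f hp⟩

/-- **Image transport of certified bounds** (Wang 2026, Lemma 1, abstract form): for invertible `P, Q` the sandwich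
`X ↦ P X Q` maps `S_K` into `S_{K'}` with `K' = (P⁻ᵀ κ Q⁻ᵀ)_{κ ∈ K}`, so a bound for `S_K` is a bound for `S_{K'}`. -/
theorem cert_image {l m n : ℕ} {K : List ℕ} {b P Pi Q Qi : ℕ} (hP : mulBits l l l Pi P = oneBits l)
    (hQ : mulBits m m m Q Qi = oneBits m) (h : Cert l m n K b) : Cert l m n (K.map (pullB l m Pi Qi)) b := by
  intro r β
  have hP' := ofBits_eq_one_of_mulBits_eq hP
  have hQ' := ofBits_eq_one_of_mulBits_eq hQ
  refine h r (β.ofSandwichLE (ofBits l l P) (ofBits l l Pi) (ofBits m m Q) (ofBits m m Qi) hP' hQ' ?_)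
  intro x hx
  refine mem_constrSub.2 fun κ' hκ' => ?_
  obtain ⟨κ1, hκ1, rfl⟩ := List.mem_map.1 hκ'
  obtain ⟨κ, hκ, rfl⟩ := List.mem_map.1 hκ1
  rw [← form_sandwich]
  have e : ofBits l l Pi * (ofBits l l P * x * ofBits m m Q) * ofBits m m Qi = x := by
    calc ofBits l l Pi * (ofBits l l P * x * ofBits m m Q) * ofBits m m Qi
        = (ofBits l l Pi * ofBits l l P) * x * (ofBits m m Q * ofBits m m Qi) := by
          simp only [Matrix.mul_assoc]
      _ = x := by rw [hP', hQ', Matrix.one_mul, Matrix.mul_one]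
  rw [e]
  exact form_eq_zero_of_mem hκ hx

/-- The image of a clique under an invertible sandwich is a clique. -/
theorem isClique_image {C : List ℕ} (hC : IsClique C) {P Pi Q Qi : ℕ}
    (hP : mulBits 3 3 3 Pi P = oneBits 3) (hQ : mulBits 3 3 3 Q Qi = oneBits 3) :
    IsClique (C.map (pullB 3 3 Pi Qi)) := by
  intro f hf g hg hne
  obtain ⟨f0, hf0, rfl⟩ := List.mem_map.1 hf
  obtain ⟨g0, hg0, rfl⟩ := List.mem_map.1 hg
  have hne0 : f0 ≠ g0 := fun e => hne (by rw [e])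
  obtain ⟨K', hfK, hgK, hK⟩ := hC f0 hf0 g0 hg0 hne0
  exact ⟨K'.map (pullB 3 3 Pi Qi), List.mem_map.2 ⟨f0, hfK, rfl⟩, List.mem_map.2 ⟨g0, hgK, rfl⟩,
    cert_image hP hQ hK⟩

/-- One validated part justification, given that all earlier parts are cliques. -/
theorem isClique_of_partJOK {reps : Reps} (hr : Hyps reps) {parts : List (List ℕ)} {k : ℕ} {j : PartJ}
    (h : partJOK reps parts k j = true) (ih : ∀ i < k, IsClique (parts.getD i [])) :
    IsClique (parts.getD k []) := by
  cases j with
  | own ws => exact isClique_of_pairsOK hr h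
  | image src P Pi Q Qi =>
    simp only [partJOK, Bool.and_eq_true, Nat.blt_eq, natBeq_eq, beq_iff_eq, mulBitsF_eq] at h
    obtain ⟨⟨⟨hsrc, hP⟩, hQ⟩, himg⟩ := h
    rw [← himg]
    have e : (parts.getD src []).map (pullBF 3 3 Pi Qi) = (parts.getD src []).map (pullB 3 3 Pi Qi) :=
      List.map_congr_left fun κ _ => pullBF_eq 3 3 Pi Qi κ
    rw [e]
    exact isClique_image (ih src hsrc) hP hQ

/-- All parts validated from `k` on, earlier ones cliques ⇒ all parts are cliques. -/
theorem isClique_of_partsOKFrom {reps : Reps} (hr : Hyps reps) {parts : List (List ℕ)} :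
    ∀ (js : List PartJ) (k : ℕ), partsOKFrom reps parts k js = true → (∀ i < k, IsClique (parts.getD i [])) →
      ∀ i < parts.length, IsClique (parts.getD i [])
  | [], k, h, ih, i, hi => by
    simp only [partsOKFrom, Nat.ble_eq] at h
    exact ih i (lt_of_lt_of_le hi h)
  | j :: js, k, h, ih, i, hi => by
    simp only [partsOKFrom, Bool.and_eq_true] at h
    refine isClique_of_partsOKFrom hr js (k + 1) h.2 (fun i' hi' => ?_) i hi
    rcases Nat.lt_succ_iff_lt_or_eq.1 hi' with hlt | rfl
    · exact ih i' hlt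
    · exact isClique_of_partJOK hr h.1 ih

/-- **All parts are cliques** when the parts check passes. -/
theorem isClique_of_partsOK {reps : Reps} (hr : Hyps reps) {parts : List (List ℕ)} {js : List PartJ}
    (h : partsOKFrom reps parts 0 js = true) : ∀ i < parts.length, IsClique (parts.getD i []) :=
  isClique_of_partsOKFrom hr js 0 h (fun _ hi0 => absurd hi0 (Nat.not_lt_zero _))

/-- The singles check certifies every listed form at 19, and at 20 unless the form lies in a part. -/
theorem single_of_singlesOK {reps : Reps} (hr : Hyps reps) {parts : List (List ℕ)} :
    ∀ {xs : List ℕ} {es : List (ℕ × Wit)}, singlesOK reps parts xs es = true →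
      ∀ x ∈ xs, Cert 3 3 3 [x] 19 ∧ (Cert 3 3 3 [x] 20 ∨ ∃ k < parts.length, x ∈ parts.getD k [])
  | [], _, _, x, hx => absurd hx List.not_mem_nil
  | _ :: _, [], h, _, _ => by simp [singlesOK] at h
  | x :: xs, e :: es, h, y, hy => by
    simp only [singlesOK, Bool.and_eq_true, Bool.or_eq_true, Nat.ble_eq, List.any_eq_true] at h
    obtain ⟨⟨⟨h19, hw⟩, hor⟩, hrest⟩ := h
    rcases List.mem_cons.1 hy with rfl | hy
    · have hc := cert_of_witOK hr hw
      refine ⟨cert_mono h19 hc, ?_⟩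
      rcases hor with h20 | ⟨C, hC, hx⟩
      · exact Or.inl (cert_mono h20 hc)
      · obtain ⟨k, hk, rfl⟩ := List.getElem_of_mem hC
        exact Or.inr ⟨k, hk, by rw [List.getD_eq_getElem _ _ hk]; simpa using hx⟩
    · exact single_of_singlesOK hr hrest y hy

/-! ## 5. The counting argument -/

/-- `ψ_{[]} ≠ 0` (the entry `(E₀₀ · E₀₀)₀₀`). -/
theorem psiK_nil_ne_zero : psiK 3 3 3 [] ≠ 0 := psiK_ne_zero (x := 1) (b := 0) (c := 0) (by decide +kernel)

/-- **Main soundness theorem.** If the parts check and the singles check pass with at most 19 parts, then every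
`𝔽₂`-bilinear computation of `(X, Y) ↦ X Y` on `3 × 3` matrices has at least 21 products. -/
theorem cert_nil_of_checks {reps : Reps} (hr : Hyps reps) {parts : List (List ℕ)} {js : List PartJ}
    {es : List (ℕ × Wit)} (hp : partsOKFrom reps parts 0 js = true)
    (hs : singlesOK reps parts allForms es = true) (hlen : parts.length ≤ 19) : Cert 3 3 3 [] 21 := by
  classical
  intro r β
  obtain ⟨r', hr'r, β', c, hcmem, hcf⟩ := exists_normal β
  suffices h21 : 21 ≤ r' by omega
  by_contra hlt
  have hle : r' ≤ 20 := by omega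
  have hsing := fun i => single_of_singlesOK hr hs (c i) (hcmem i)
  have hcl := isClique_of_partsOK hr hp
  -- one product forces 20
  obtain ⟨i₀, _⟩ := exists_f_ne_zero β' psiK_nil_ne_zero
  have h20 : 20 ≤ r' := by
    have := add_card_le_of_cert β' c hcf [c i₀] {i₀} (fun i hi => by simp [Finset.mem_singleton.1 hi])
      (hsing i₀).1
    simp only [Finset.card_singleton] at this
    omega
  -- every form lies in a part (rank-3 forms are excluded)
  have hpart : ∀ i, ∃ k, k < parts.length ∧ c i ∈ parts.getD k [] := by
    intro i
    rcases (hsing i).2 with h | ⟨k, hk, hx⟩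
    · have := add_card_le_of_cert β' c hcf [c i] {i} (fun i' hi => by simp [Finset.mem_singleton.1 hi]) h
      simp only [Finset.card_singleton] at this
      omega
    · exact ⟨k, hk, hx⟩
  choose kk hklt hkk using hpart
  -- the part index is injective on products
  let KK : Fin r' → Fin parts.length := fun i => ⟨kk i, hklt i⟩
  have hinj : Function.Injective KK := by
    intro i j hij
    have hij' : kk i = kk j := congrArg Fin.val hij
    by_contra hne
    have hci : c i ∈ parts.getD (kk i) [] := hkk i
    have hcj : c j ∈ parts.getD (kk i) [] := by rw [hij']; exact hkk j
    have hC : IsClique (parts.getD (kk i) []) := hcl _ (hklt i)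
    have hcard : ({i, j} : Finset (Fin r')).card = 2 := Finset.card_pair hne
    by_cases hcc : c i = c j
    · have := add_card_le_of_cert β' c hcf [c i] {i, j}
        (fun i' hi => by
          simp only [Finset.mem_insert, Finset.mem_singleton] at hi
          rcases hi with rfl | rfl
          · exact List.mem_cons_self
          · rw [← hcc]; exact List.mem_cons_self)
        (hsing i).1
      rw [hcard] at this
      omega
    · obtain ⟨K', hiK, hjK, hK⟩ := hC (c i) hci (c j) hcj hcc
      have := add_card_le_of_cert β' c hcf K' {i, j}
        (fun i' hi => by
          simp only [Finset.mem_insert, Finset.mem_singleton] at hi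
          rcases hi with rfl | rfl
          · exact hiK
          · exact hjK)
        hK
      rw [hcard] at this
      omega
  have hcard := Fintype.card_le_of_injective KK hinj
  simp only [Fintype.card_fin] at hcard
  omega

/-- **Reading off the rank bound**: the checks give `21 ≤ R_{𝔽₂}(⟨3,3,3⟩)` under the hypothesis orbit bounds. -/
theorem rankGe21F2_of_checks {reps : Reps} (hr : Hyps reps) {parts : List (List ℕ)} {js : List PartJ}
    {es : List (ℕ × Wit)} (hp : partsOKFrom reps parts 0 js = true)
    (hs : singlesOK reps parts allForms es = true) (hlen : parts.length ≤ 19) : RankGe21F2 := by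
  unfold RankGe21F2
  exact le_tensorRank_matMulTensor_of_forall_constrained (subOf 3 3 []) (cert_nil_of_checks hr hp hs hlen)

end Summit.Ventures.MM22.GF2Cert.Root21
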